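import Summits.CriticalPhenomena.PercolationContinuityZ3.Theorems.NearLinearTwoClusterDecay.Negative.LoadBearing

/-!
# `NearLinearTwoClusterDecay` (stmt-CriticalPhenomena-5785) — negative side III: structure
# (the BK road is summit-strength; the BK square; monotonicity in the aspect exponent; subcritical truth)

From the standing disprover's `Cruxes/NearLinearTwoClusterDecay/Disproof.lean` (cdisprove v6, §(b), §(a')),
landed by the line lead (seat c2).  `crossingEvt n m` = one open crossing `Λ(n) → ∂ⁱⁿΛ(m)` inside `Λ(m)`;
`CrossingDecay α` = its probability at `m = ⌈n^α⌉` tends to `0`.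

* `atExponent_of_crossingDecay`, `percolationContinuityZ3_of_crossingDecay` — crossing decay at ANY exponent
  implies the crux family member by monotonicity AND proves `θ(p_c) = 0` outright
  (`θ ≤ P(crossing)`): the monotone road to `U` is summit-strength; `U` carries information for the race only
  in the counterfactual `θ(p_c) > 0` world.
* `real_twoClusterEvt_le_sq` — BK: `P(twoClusterEvt n m) ≤ P(crossingEvt n m)²` (the two clusters carry
  edge-disjoint open crossings; `bk_finitary`).
* `real_twoClusterEvt_antitone`, `atExponent_mono` — the two-cluster probability is antitone in the outer
  box, so `{α ≥ 1 | AtExponent α}` is an up-set: `U(1/6)` gives decay at every `α ≥ 7/6`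
  (`atExponent_of_nearLinearTwoClusterDecay`) and follows from decay at any `α ∈ [1, 7/6]`
  (`nearLinearTwoClusterDecay_of_atExponent`).
* `subcritical_crossing_decay`, `subcritical_twoCluster_decay` — for every `p < p_c(ℤ³)` the crux statement
  (indeed single-crossing decay) is TRUE (union bound + translation invariance + the tree's proved sharpness):
  criticality from below is not load-bearing.
-/

namespace Summit.CriticalPhenomena.PercolationContinuityZ3.Theorems.NearLinearTwoClusterDecay.Negative

open MeasureTheory Filter Topology
open Literature.Probability.LatticeModels Literature.Probability.Percolation
open Summit.CriticalPhenomena.PercolationContinuityZ3.Theses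

noncomputable section

/-- The single-crossing event of the annulus `(Λ(n), Λ(m))`, inside `Λ(m)`. [folklore] -/
def crossingEvt (n m : ℕ) : Set (BondConfig (Site 3)) :=
  {ω | ∃ x ∈ box 3 n, ∃ y ∈ innerBoundary (zdGraph 3) (box 3 m), ω ∈ openConnIn ↑(box 3 m) x y}

/-- Crossing decay at exponent `α`. [folklore] -/
def CrossingDecay (α : ℝ) : Prop :=
  Tendsto (fun n : ℕ => critBond.real (crossingEvt n ⌈(n : ℝ) ^ α⌉₊)) atTop (𝓝 0)

/-- Two distinct crossing clusters give in particular one crossing. [folklore] -/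
theorem twoClusterEvt_subset_crossingEvt (n m : ℕ) : twoClusterEvt n m ⊆ crossingEvt n m :=
  fun _ ⟨x, hx, _, _, y, hy, _, _, hxy, _, _⟩ => ⟨x, hx, y, hy, hxy⟩

/-- Crossing decay implies the crux family member, by monotonicity. [folklore] -/
theorem atExponent_of_crossingDecay {α : ℝ} (h : CrossingDecay α) : AtExponent α := by
  refine squeeze_zero (fun n => measureReal_nonneg) (fun n => ?_) h
  exact measureReal_mono (twoClusterEvt_subset_crossingEvt _ _)

/-- `θ(p_c) ≤ P_{p_c}(crossing of (Λ(n), Λ(m)))` for every `n, m`: the one-arm event of the origin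
is a crossing. [folklore] -/
theorem theta_le_real_crossingEvt (n m : ℕ) :
    theta (zdGraph 3) 0 (criticalProbI 3) ≤ critBond.real (crossingEvt n m) := by
  refine (DCT16.theta_le_real_siteToBoundary (criticalProbI 3) m).trans (measureReal_mono ?_)
  rintro ω ⟨y, hy, hω⟩
  exact ⟨0, zero_mem_box 3 n, y, hy, hω⟩

/-- **Crossing decay at any exponent proves the summit conjunct** `θ(p_c) = 0` on `ℤ³`. [folklore] -/
theorem percolationContinuityZ3_of_crossingDecay {α : ℝ} (h : CrossingDecay α) :
    _root_.PercolationContinuityZ3 := by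
  show Literature.Probability.Percolation.PercolationContinuityZ3
  rw [percolationContinuityZ3_iff]
  refine le_antisymm ?_ measureReal_nonneg
  exact ge_of_tendsto' h fun n => theta_le_real_crossingEvt n _


/-! ## (b) Quantitative reduction: `P(two clusters) ≤ P(one crossing)²` (BK)

Two distinct crossing clusters carry edge-DISJOINT open crossings, so the crux event lies in the
disjoint occurrence `crossingEvt □ crossingEvt`, and the tree's BK inequality for finitary
increasing events (`bk_finitary`) squares the crossing probability: in the orthodox picture
(`P(Λ(n) ↔ ∂Λ(n^{7/6})) ≈ n^{-0.08}`) the crux probability decays like `n^{-0.16}` or faster. -/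

/-- Finite open witness of an open path inside `S`, together with the cluster invariant: every
endpoint of a witness edge is joined to the start inside `S`. [folklore] -/
theorem exists_finset_witness_of_pathIn {ω : BondConfig (Site 3)} {S : Set (Site 3)} {x y : Site 3}
    (h : PathIn (openGraph ω) S x y) :
    ∃ K : Finset (Sym2 (Site 3)), (↑K : Set (Sym2 (Site 3))) ⊆ ω ∧
      PathIn (openGraph (↑K : Set (Sym2 (Site 3)))) S x y ∧
      ∀ e ∈ K, ∀ v ∈ e, PathIn (openGraph ω) S x v := by
  classical
  obtain ⟨hx, hr⟩ := h
  induction hr with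
  | refl => exact ⟨∅, by simp, PathIn.refl hx, by simp⟩
  | @tail b c hxb hbc ih =>
    obtain ⟨K, hKω, hK, hinv⟩ := ih
    have hb : PathIn (openGraph ω) S x b := ⟨hx, hxb⟩
    have hadj := (openGraph_adj ω b c).1 hbc.1
    refine ⟨insert s(b, c) K, ?_, ?_, ?_⟩
    · rw [Finset.coe_insert]; exact Set.insert_subset hadj.1 hKω
    · refine (hK.mono_graph (openGraph_mono ?_)).tail ?_ hbc.2
      · rw [Finset.coe_insert]; exact Set.subset_insert _ _
      · rw [openGraph_adj, Finset.coe_insert]; exact ⟨Set.mem_insert _ _, hadj.2⟩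
    · intro e he v hv
      rcases Finset.mem_insert.1 he with rfl | he
      · rcases Sym2.mem_iff.1 hv with rfl | rfl
        · exact hb
        · exact hb.tail hbc.1 hbc.2
      · exact hinv e he v hv

/-- The single-crossing event is increasing. [folklore] -/
theorem isUpperSet_crossingEvt (n m : ℕ) : IsUpperSet (crossingEvt n m) := by
  rintro ω ω' hle ⟨x, hx, y, hy, h⟩
  exact ⟨x, hx, y, hy, isUpperSet_openConnIn _ _ _ hle h⟩

/-- The single-crossing event is finitary (witnessed by the finitely many edges of an open path). [folklore] -/
theorem isFinitary_crossingEvt (n m : ℕ) : IsFinitary (crossingEvt n m) := by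
  rintro ω ⟨x, hx, y, hy, h⟩
  obtain ⟨K, hKω, hK, -⟩ := exists_finset_witness_of_pathIn (DCT16.mem_openConnIn_iff_pathIn.1 h)
  exact ⟨K, hKω, x, hx, y, hy, DCT16.mem_openConnIn_iff_pathIn.2 hK⟩

/-- **Two distinct crossing clusters occur disjointly**: `twoClusterEvt ⊆ crossingEvt □ crossingEvt`
(the open witnesses of the two crossings are edge-disjoint, since a common edge would join the two
clusters inside `Λ(m)`). [folklore] -/
theorem twoClusterEvt_subset_disjointOccurrence (n m : ℕ) :
    twoClusterEvt n m ⊆ crossingEvt n m □ crossingEvt n m := by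
  classical
  rintro ω ⟨x, hx, x', hx', y, hy, y', hy', hxy, hx'y', hxx'⟩
  rw [(isUpperSet_crossingEvt n m).mem_disjointOccurrence_iff (isUpperSet_crossingEvt n m)]
  obtain ⟨K, hKω, hK, hKinv⟩ :=
    exists_finset_witness_of_pathIn (DCT16.mem_openConnIn_iff_pathIn.1 hxy)
  obtain ⟨L, hLω, hL, hLinv⟩ :=
    exists_finset_witness_of_pathIn (DCT16.mem_openConnIn_iff_pathIn.1 hx'y')
  refine ⟨↑K, hKω, ↑L, hLω, ?_, ⟨x, hx, y, hy, DCT16.mem_openConnIn_iff_pathIn.2 hK⟩,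
    ⟨x', hx', y', hy', DCT16.mem_openConnIn_iff_pathIn.2 hL⟩⟩
  rw [Finset.disjoint_coe, Finset.disjoint_left]
  intro e heK heL
  induction e using Sym2.ind with
  | h a b =>
    have h1 := hKinv _ heK a (Sym2.mem_mk_left a b)
    have h2 := hLinv _ heL a (Sym2.mem_mk_left a b)
    exact hxx' (DCT16.mem_openConnIn_iff_pathIn.2 (h1.trans h2.symm))

/-- **BK reduction**: `P_{p_c}(two-cluster event) ≤ P_{p_c}(single crossing)²` for every `(n, m)`. [folklore] -/
theorem real_twoClusterEvt_le_sq (n m : ℕ) :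
    critBond.real (twoClusterEvt n m) ≤ critBond.real (crossingEvt n m) ^ 2 := by
  rw [sq]
  exact (measureReal_mono (twoClusterEvt_subset_disjointOccurrence n m)).trans
    (bk_finitary _ _ (isUpperSet_crossingEvt n m) (isUpperSet_crossingEvt n m)
      (isFinitary_crossingEvt n m) (isFinitary_crossingEvt n m))


/-! ## (b) Monotonicity in the aspect: decay at exponent `α ≥ 1` passes to every `α' ≥ α`

The two-cluster event is the union over pairs `x, x' ∈ Λ(k)` of the tree's `badPair m x x'`
(`UniquenessZone.lean`), which is antitone in `m ≥ k` (first exit of the arms; `badPair_add_antitone`).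
Hence the set of exponents `α ≥ 1` at which the two-cluster probability decays is an UP-SET: the
crux `U(1/6)` gives decay at every `α ≥ 7/6`, is implied by decay at any `α ∈ [1, 7/6]`, and
together with `not_…_of_exponent_le_one` the threshold exponent `α* = inf {α | decay}` satisfies
`1 ≤ α*`; the crux asserts `α* ≤ 7/6` (print, site model: `α* ≤ 42.17`, Cerf 2015 Thm 1.2). -/

/-- The two-cluster event as a union of the tree's bad-pair events. [folklore] -/
theorem mem_twoClusterEvt_iff {k m : ℕ} {ω : BondConfig (Site 3)} :
    ω ∈ twoClusterEvt k m ↔ ∃ x ∈ box 3 k, ∃ x' ∈ box 3 k, ω ∈ badPair m x x' := by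
  constructor
  · rintro ⟨x, hx, x', hx', y, hy, y', hy', h1, h2, h3⟩
    exact ⟨x, hx, x', hx', ⟨⟨y, hy, h1⟩, ⟨y', hy', h2⟩⟩, h3⟩
  · rintro ⟨x, hx, x', hx', ⟨⟨y, hy, h1⟩, ⟨y', hy', h2⟩⟩, h3⟩
    exact ⟨x, hx, x', hx', y, hy, y', hy', h1, h2, h3⟩

/-- **The two-cluster probability is antitone in the outer box** `m ≥ k`. [folklore] -/
theorem real_twoClusterEvt_antitone {k m m' : ℕ} (hkm : k ≤ m) (hmm' : m ≤ m') :
    critBond.real (twoClusterEvt k m') ≤ critBond.real (twoClusterEvt k m) := by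
  refine DCT16.real_mono_of_forall_subset_edgeSet _ _ fun ω hω h => ?_
  rw [mem_twoClusterEvt_iff] at h ⊢
  obtain ⟨x, hx, x', hx', hb⟩ := h
  obtain ⟨j, rfl⟩ := Nat.exists_eq_add_of_le hkm
  obtain ⟨i, rfl⟩ := Nat.exists_eq_add_of_le hmm'
  refine ⟨x, hx, x', hx', ?_⟩
  rw [add_assoc] at hb
  exact badPair_add_antitone hx hx' hω (Nat.le_add_right j i) hb

/-- `n ≤ ⌈n^α⌉₊` for `n ≥ 1`, `α ≥ 1`. [folklore] -/
theorem le_ceil_rpow {n : ℕ} {α : ℝ} (hn : 1 ≤ n) (hα : 1 ≤ α) : n ≤ ⌈(n : ℝ) ^ α⌉₊ := by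
  have hn' : (1 : ℝ) ≤ n := by exact_mod_cast hn
  calc n = ⌈((n : ℕ) : ℝ)⌉₊ := (Nat.ceil_natCast n).symm
    _ ≤ ⌈(n : ℝ) ^ α⌉₊ := Nat.ceil_mono (by
        calc (n : ℝ) = (n : ℝ) ^ (1 : ℝ) := (Real.rpow_one _).symm
          _ ≤ (n : ℝ) ^ α := Real.rpow_le_rpow_of_exponent_le hn' hα)

/-- **`AtExponent` is monotone in the exponent on `[1, ∞)`.** [folklore] -/
theorem atExponent_mono {α α' : ℝ} (h1 : 1 ≤ α) (hαα' : α ≤ α') (h : AtExponent α) :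
    AtExponent α' := by
  refine squeeze_zero' (Eventually.of_forall fun n => measureReal_nonneg) ?_ h
  filter_upwards [eventually_ge_atTop 1] with n hn
  have hn' : (1 : ℝ) ≤ n := by exact_mod_cast hn
  exact real_twoClusterEvt_antitone (le_ceil_rpow hn h1)
    (Nat.ceil_mono (Real.rpow_le_rpow_of_exponent_le hn' hαα'))

/-- The crux gives decay at every exponent `α ≥ 7/6`. [folklore] -/
theorem atExponent_of_nearLinearTwoClusterDecay {α : ℝ} (hα : (7 : ℝ) / 6 ≤ α)
    (h : PercShatteringRace.NearLinearTwoClusterDecay) : AtExponent α :=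
  atExponent_mono (by norm_num) hα h

/-- Decay at any exponent `α ∈ [1, 7/6]` gives the crux. [folklore] -/
theorem nearLinearTwoClusterDecay_of_atExponent {α : ℝ} (h1 : 1 ≤ α) (hα : α ≤ (7 : ℝ) / 6)
    (h : AtExponent α) : PercShatteringRace.NearLinearTwoClusterDecay :=
  atExponent_mono h1 hα h


/-! ## (a') Criticality from below is NOT load-bearing: the statement holds for every `p < p_c`

Union bound over `Λ(n)`, translation invariance and first exit (`DCT16.armEvent_of_pathIn`,
`DCT16.real_armEvent`) give `P_p(crossing of (Λ(n), Λ(m))) ≤ (2n+1)³ P_p(0 ↔ ∂Λ(m-n))`, and the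
tree's PROVED sharpness (`DCT16.perc_sharpness_holds`, Menshikov / Aizenman–Barsky /
Duminil-Copin–Tassion) makes this summable below `p_c` as soon as `m ≥ 2n`.  So the two-cluster
statement at the crux's aspect is TRUE for every `p < p_c`: a refutation must be a genuinely
critical (or supercritical-at-`p_c`) phenomenon. (Above `p_c` it is also expected true, by
uniqueness in slabs; not formalised.) -/

/-- First exit: a crossing of `(Λ(n), Λ(m))` from `x ∈ Λ(n)` contains an arm of length `m - n`
at `x`. [folklore] -/
theorem exists_armEvent_of_crossingEvt {n m : ℕ} (hnm : n ≤ m) {ω : BondConfig (Site 3)}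
    (hω : ω ⊆ (zdGraph 3).edgeSet) (h : ω ∈ crossingEvt n m) :
    ∃ x ∈ box 3 n, ω ∈ DCT16.armEvent x (m - n) := by
  obtain ⟨x, hx, y, hy, hxy⟩ := h
  refine ⟨x, hx, DCT16.armEvent_of_pathIn hω (DCT16.mem_openConnIn_iff_pathIn.1 hxy) ?_⟩
  by_cases hbox : y - x ∈ box 3 (m - n)
  · right
    rw [mem_innerBoundary_iff]
    refine ⟨hbox, ?_⟩
    obtain ⟨hym, z, hz, hadj⟩ := mem_innerBoundary_iff.1 hy
    rw [mem_box] at hym hbox hx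
    have hz' : ∃ j, ¬(-((m : ℕ) : ℤ) ≤ z j ∧ z j ≤ m) := by
      by_contra hcon
      push Not at hcon
      exact hz (mem_box.2 hcon)
    obtain ⟨j, hj⟩ := hz'
    have hyj := hym j
    have hxj := hx j
    have hbj := hbox j
    simp only [Pi.sub_apply] at hbj
    rw [zdGraph_adj_iff] at hadj
    obtain ⟨i, hi⟩ := hadj
    by_cases hji : j = i
    · subst hji
      rcases hi with hi | hi
      · have hzj : z j = y j + 1 := by rw [hi]; simp
        refine ⟨y - x + Pi.single j 1, ?_, ?_⟩
        · rw [mem_box]; intro hcon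
          have := hcon j
          simp only [Pi.add_apply, Pi.sub_apply, Pi.single_eq_same] at this
          omega
        · rw [zdGraph_adj_iff]; exact ⟨j, Or.inl rfl⟩
      · have hzj : y j = z j + 1 := by rw [hi]; simp
        refine ⟨y - x - Pi.single j 1, ?_, ?_⟩
        · rw [mem_box]; intro hcon
          have := hcon j
          simp only [Pi.sub_apply, Pi.single_eq_same] at this
          omega
        · rw [zdGraph_adj_iff]; exact ⟨j, Or.inr (by simp)⟩
    · exfalso
      rcases hi with hi | hi
      · have hzj : z j = y j := by rw [hi]; simp [hji]
        omega
      · have hzj : y j = z j := by rw [hi]; simp [hji]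
        omega
  · exact Or.inl hbox

/-- **Union bound + translation invariance**:
`P_p(crossing of (Λ(n), Λ(m))) ≤ (2n+1)³ · P_p(0 ↔ ∂Λ(m - n))`, every `p`, `n ≤ m`. [folklore] -/
theorem real_crossingEvt_le (p : unitInterval) {n m : ℕ} (hnm : n ≤ m) :
    (bondPercolation (zdGraph 3) p).real (crossingEvt n m) ≤
      (2 * n + 1) ^ 3 * (bondPercolation (zdGraph 3) p).real (siteToBoundary 3 (m - n)) := by
  classical
  calc (bondPercolation (zdGraph 3) p).real (crossingEvt n m)
      ≤ (bondPercolation (zdGraph 3) p).real (⋃ x ∈ box 3 n, DCT16.armEvent x (m - n)) :=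
        DCT16.real_mono_of_forall_subset_edgeSet _ _ fun ω hω h => by
          obtain ⟨x, hx, hxarm⟩ := exists_armEvent_of_crossingEvt hnm hω h
          exact Set.mem_biUnion hx hxarm
    _ ≤ ∑ x ∈ box 3 n, (bondPercolation (zdGraph 3) p).real (DCT16.armEvent x (m - n)) :=
        measureReal_biUnion_finset_le _ _
    _ = ∑ x ∈ box 3 n, (bondPercolation (zdGraph 3) p).real (siteToBoundary 3 (m - n)) :=
        Finset.sum_congr rfl fun x _ => DCT16.real_armEvent p x _
    _ = (2 * n + 1) ^ 3 * (bondPercolation (zdGraph 3) p).real (siteToBoundary 3 (m - n)) := by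
        rw [Finset.sum_const, card_box, nsmul_eq_mul]; push_cast; ring

/-- **Subcritical crossing decay** (sharpness): for `p < p_c(ℤ³)` and any outer scale with
`m n ≥ 2n` eventually, `P_p(crossing of (Λ(n), Λ(m n))) → 0`. [folklore] -/
theorem subcritical_crossing_decay (p : unitInterval)
    (hp : (p : ℝ) < criticalProb (zdGraph 3) (0 : Site 3)) {m : ℕ → ℕ}
    (hm : ∀ᶠ n in atTop, 2 * n ≤ m n) :
    Tendsto (fun n : ℕ => (bondPercolation (zdGraph 3) p).real (crossingEvt n (m n))) atTop (𝓝 0) := by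
  obtain ⟨c, hc, hdecay⟩ := DCT16.perc_sharpness_holds (d := 3) (by norm_num) p hp
  have h1 : Tendsto (fun x : ℝ => x ^ 3 / Real.exp (c * x)) atTop (𝓝 0) :=
    (isLittleO_pow_exp_pos_mul_atTop 3 hc).tendsto_div_nhds_zero
  have h2 : Tendsto (fun n : ℕ => (27 : ℝ) * ((n : ℝ) ^ 3 / Real.exp (c * n))) atTop (𝓝 0) := by
    simpa using (h1.comp tendsto_natCast_atTop_atTop).const_mul (27 : ℝ)
  refine squeeze_zero' (Eventually.of_forall fun n => measureReal_nonneg) ?_ h2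
  filter_upwards [hm, eventually_ge_atTop 1] with n hmn hn1
  have hnm : n ≤ m n := by omega
  have hk : n ≤ m n - n := by omega
  have hn1' : (1 : ℝ) ≤ n := by exact_mod_cast hn1
  calc (bondPercolation (zdGraph 3) p).real (crossingEvt n (m n))
      ≤ (2 * n + 1) ^ 3 * (bondPercolation (zdGraph 3) p).real (siteToBoundary 3 (m n - n)) :=
        real_crossingEvt_le p hnm
    _ ≤ (2 * n + 1) ^ 3 * Real.exp (-c * ↑(m n - n)) :=
        mul_le_mul_of_nonneg_left (hdecay _) (by positivity)
    _ ≤ (3 * n) ^ 3 * Real.exp (-c * n) := by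
        apply mul_le_mul _ _ (by positivity) (by positivity)
        · exact pow_le_pow_left₀ (by positivity) (by linarith) 3
        · exact Real.exp_le_exp.2 (by
            have : (n : ℝ) ≤ ((m n - n : ℕ) : ℝ) := by exact_mod_cast hk
            nlinarith)
    _ = 27 * ((n : ℝ) ^ 3 / Real.exp (c * n)) := by
        rw [neg_mul, Real.exp_neg, div_eq_mul_inv]; ring

/-- **The crux statement is TRUE strictly below `p_c`** (so criticality-from-below is not what
makes it hard): for every `p < p_c(ℤ³)`, the two-cluster probability of `(Λ(n), Λ(⌈n^{7/6}⌉))`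
under `P_p` tends to `0`. [folklore] -/
theorem subcritical_twoCluster_decay (p : unitInterval)
    (hp : (p : ℝ) < criticalProb (zdGraph 3) (0 : Site 3)) :
    Tendsto (fun n : ℕ => (bondPercolation (zdGraph 3) p).real
      (twoClusterEvt n ⌈(n : ℝ) ^ ((7 : ℝ) / 6)⌉₊)) atTop (𝓝 0) := by
  have hm : ∀ᶠ n : ℕ in atTop, 2 * n ≤ ⌈(n : ℝ) ^ ((7 : ℝ) / 6)⌉₊ := by
    filter_upwards [eventually_ge_atTop 64] with n hn
    have hn' : (64 : ℝ) ≤ n := by exact_mod_cast hn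
    have h2 : (2 : ℝ) = ((2 : ℝ) ^ (6 : ℕ)) ^ ((1 : ℝ) / 6) := by
      rw [show (1 : ℝ) / 6 = ((6 : ℕ) : ℝ)⁻¹ by norm_num,
        Real.pow_rpow_inv_natCast (by norm_num) (by norm_num)]
    have h64 : (2 : ℝ) ≤ (n : ℝ) ^ ((1 : ℝ) / 6) := by
      rw [h2]
      exact Real.rpow_le_rpow (by norm_num) (by norm_num; exact_mod_cast hn) (by norm_num)
    have key : (2 * n : ℝ) ≤ (n : ℝ) ^ ((7 : ℝ) / 6) := by
      calc (2 * n : ℝ) = 2 * (n : ℝ) ^ (1 : ℝ) := by rw [Real.rpow_one]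
        _ ≤ (n : ℝ) ^ ((1 : ℝ) / 6) * (n : ℝ) ^ (1 : ℝ) := by gcongr
        _ = (n : ℝ) ^ ((7 : ℝ) / 6) := by
            rw [← Real.rpow_add (by positivity)]; norm_num
    have : ((2 * n : ℕ) : ℝ) ≤ (⌈(n : ℝ) ^ ((7 : ℝ) / 6)⌉₊ : ℝ) := by
      push_cast; exact key.trans (Nat.le_ceil _)
    exact_mod_cast this
  refine squeeze_zero' (Eventually.of_forall fun n => measureReal_nonneg)
    (Eventually.of_forall fun n => measureReal_mono (twoClusterEvt_subset_crossingEvt _ _))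
    (subcritical_crossing_decay p hp hm)



/-! ## Inline headline forms (over tree declarations only) -/

/-- **The BK/monotone road is summit-strength**, inline form: if the single-crossing probability of
`(Λ(n), Λ(⌈n^α⌉))` tends to `0` for some exponent `α`, then `θ(p_c) = 0` on `ℤ³`
(`PercolationContinuityZ3`). [folklore] -/
theorem percolationContinuityZ3_of_crossing_tendsto_zero (α : ℝ)
    (h : Tendsto (fun n : ℕ => (bondPercolation (zdGraph 3) (criticalProbI 3)).real
      {ω | ∃ x ∈ box 3 n, ∃ y ∈ innerBoundary (zdGraph 3) (box 3 ⌈(n : ℝ) ^ α⌉₊),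
        ω ∈ openConnIn ↑(box 3 ⌈(n : ℝ) ^ α⌉₊) x y}) atTop (𝓝 0)) :
    _root_.PercolationContinuityZ3 :=
  percolationContinuityZ3_of_crossingDecay (α := α) h

/-- **Monotonicity of the crux family in the aspect exponent**, inline form: two-cluster decay at an
exponent `α ≥ 1` gives two-cluster decay at every `α' ≥ α` (so `U(1/6)` gives `U(b)` for all
`b ≥ 1/6`, and decay at any `α ∈ [1, 7/6]` gives the crux). [folklore] -/
theorem twoCluster_tendsto_zero_mono {α α' : ℝ} (h1 : 1 ≤ α) (hαα' : α ≤ α')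
    (h : Tendsto (fun n : ℕ => (bondPercolation (zdGraph 3) (criticalProbI 3)).real
      {ω | ∃ x ∈ box 3 n, ∃ x' ∈ box 3 n, ∃ y ∈ innerBoundary (zdGraph 3) (box 3 ⌈(n : ℝ) ^ α⌉₊),
        ∃ y' ∈ innerBoundary (zdGraph 3) (box 3 ⌈(n : ℝ) ^ α⌉₊),
          ω ∈ openConnIn ↑(box 3 ⌈(n : ℝ) ^ α⌉₊) x y ∧ ω ∈ openConnIn ↑(box 3 ⌈(n : ℝ) ^ α⌉₊) x' y' ∧
          ω ∉ openConnIn ↑(box 3 ⌈(n : ℝ) ^ α⌉₊) x x'}) atTop (𝓝 0)) :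
    Tendsto (fun n : ℕ => (bondPercolation (zdGraph 3) (criticalProbI 3)).real
      {ω | ∃ x ∈ box 3 n, ∃ x' ∈ box 3 n, ∃ y ∈ innerBoundary (zdGraph 3) (box 3 ⌈(n : ℝ) ^ α'⌉₊),
        ∃ y' ∈ innerBoundary (zdGraph 3) (box 3 ⌈(n : ℝ) ^ α'⌉₊),
          ω ∈ openConnIn ↑(box 3 ⌈(n : ℝ) ^ α'⌉₊) x y ∧ ω ∈ openConnIn ↑(box 3 ⌈(n : ℝ) ^ α'⌉₊) x' y' ∧
          ω ∉ openConnIn ↑(box 3 ⌈(n : ℝ) ^ α'⌉₊) x x'}) atTop (𝓝 0) :=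
  atExponent_mono h1 hαα' h

/-- **BK square**, inline form at `p_c`: for all `n m`,
`P(two-cluster event of (Λ(n), Λ(m))) ≤ P(one crossing of (Λ(n), Λ(m)))²`. [folklore] -/
theorem real_twoCluster_le_crossing_sq (n m : ℕ) :
    (bondPercolation (zdGraph 3) (criticalProbI 3)).real
        {ω | ∃ x ∈ box 3 n, ∃ x' ∈ box 3 n, ∃ y ∈ innerBoundary (zdGraph 3) (box 3 m),
          ∃ y' ∈ innerBoundary (zdGraph 3) (box 3 m),
            ω ∈ openConnIn ↑(box 3 m) x y ∧ ω ∈ openConnIn ↑(box 3 m) x' y' ∧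
            ω ∉ openConnIn ↑(box 3 m) x x'} ≤
      (bondPercolation (zdGraph 3) (criticalProbI 3)).real
        {ω | ∃ x ∈ box 3 n, ∃ y ∈ innerBoundary (zdGraph 3) (box 3 m), ω ∈ openConnIn ↑(box 3 m) x y} ^ 2 :=
  real_twoClusterEvt_le_sq n m

/-- **The crux statement is TRUE strictly below `p_c`**, inline form. [folklore] -/
theorem subcritical_twoCluster_tendsto_zero (p : unitInterval)
    (hp : (p : ℝ) < criticalProb (zdGraph 3) (0 : Site 3)) :
    Tendsto (fun n : ℕ => (bondPercolation (zdGraph 3) p).real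
      {ω | ∃ x ∈ box 3 n, ∃ x' ∈ box 3 n,
        ∃ y ∈ innerBoundary (zdGraph 3) (box 3 ⌈(n : ℝ) ^ ((7 : ℝ) / 6)⌉₊),
        ∃ y' ∈ innerBoundary (zdGraph 3) (box 3 ⌈(n : ℝ) ^ ((7 : ℝ) / 6)⌉₊),
          ω ∈ openConnIn ↑(box 3 ⌈(n : ℝ) ^ ((7 : ℝ) / 6)⌉₊) x y ∧
          ω ∈ openConnIn ↑(box 3 ⌈(n : ℝ) ^ ((7 : ℝ) / 6)⌉₊) x' y' ∧
          ω ∉ openConnIn ↑(box 3 ⌈(n : ℝ) ^ ((7 : ℝ) / 6)⌉₊) x x'}) atTop (𝓝 0) :=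
  subcritical_twoCluster_decay p hp

end

end Summit.CriticalPhenomena.PercolationContinuityZ3.Theorems.NearLinearTwoClusterDecay.Negative
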